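import Mathlib
import Literature.NumberTheory.LFunctions.Zhang2022.Section12Lemma121
import Literature.NumberTheory.LFunctions.CharacterHarmonicTails
import Literature.NumberTheory.LFunctions.PartialSumsFourierCutoff
import HarnessLib

/-!
# Zhang (2022), §12 Lemma 12.1 (p. 68), first clause: `Σ_l χ(l)ϰ₁₃(dl)l^{β_j−1} ≪ T^{−c}` for
# `d ≤ P″₁/T` — by the Pólya–Vinogradov inequality and partial summation, kernel-checked

Topic `Literature/NumberTheory/LFunctions/Zhang2022` (Landau–Siegel audit tree; verdict-neutral;
campaign D-0069, layer L3, cone leaf C31 `Skeleton.Lemma121`, typed node `Typed.Sec12B.U018`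
first conjunct). Y. Zhang, *Discrete mean estimates and the Landau–Siegel zero*,
arXiv:2211.02515v1 (2022) [Zhang2022LandauSiegel] — **an unrefereed manuscript under adjudication;
this file PROVES one clause of its Lemma 12.1 and asserts nothing about its Theorems 1–2.**

Lemma 12.1, first display, first case (p. 68, tex L3479–3481; proof tex L3492: "In the case
`d ≤ P″₁` the results follow by the Polya-Vinogradov inequality and partial summation"): for
`d ≤ P″₁/T`, `Σ_l χ(l)ϰ₁₃(dl)/l^{1−β_j} ≪ T^{−c}`. Here (`sum121_range_one`): for every real `c′`,
all large `D` (`𝓛 ≥ 1024 + 32|c′|`), every real primitive `χ (mod D)` — hypothesis (A) is not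
needed — `j ∈ {1,2,3}`, `1 ≤ d ≤ P″₁/T`: `‖Σ‖ ≤ T^{−1/4}`; `U018_first_clause` restates it in the
shape of the first conjunct of `Typed.Sec12B.U018 c′` (`c = 1/4`, `C = 1`).

Route: with `Y = P″₁/d ≥ T` and `X = P″₂/d = P^{0.004}Y`, the sum is `Σ_{Y<l<X} χ(l)F(l)` with
`F(x) = (log P₁)⁻¹(x/Y)^{−β₆}log(x/Y)x^{β_j−1} = K·x^{e}log(x/Y)`, `K = (log P₁)⁻¹Y^{β₆}`,
`e = β_j − 1 − β₆` (`Re e = −1`, `‖e‖ ≤ 2`); `‖F′(x)‖ ≤ ‖K‖(‖e‖log(X/Y) + 1)/x²` (mean value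
inequality step by step, `Σ_{n>k}n⁻² ≤ 1/k`), `‖F(X)‖ ≤ ‖K‖log(X/Y)/Y`; Abel summation
(`PartialSums.norm_sum_Ioc_mul_le_abel`) against the window bound `‖Σ_{N<n≤M}χ(n)‖ ≤ √D(1+𝓛)`
(F-16, tree `CharacterTails.norm_window_le_polyaVinogradov`) gives `≤ 0.05·√D(1+𝓛)/Y`, and
`√D(1+𝓛) ≤ e^{3𝓛/2} ≤ T^{3/4}` once `𝓛^{0.1} ≥ 2`. No named fact; axioms standard.

The SECOND case of the display ("`≪ α₁` if `P″₁/T < d ≤ P″₁`") is NOT derivable at the printed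
strength: at `d = ⌊P″₁⌋` the sum equals `−L′(1,χ)(d/P″₁)^{−β₆}/log P₁ + O(𝓛⁻¹⁵)`, so it needs the
(A)-conditional bound `L′(1,χ) ≪ 𝓛` (campaign ledger `G-d35-1`). Its SURVIVING WEAK FORM is proved
(`sum121_range_two_weak`, `sum121_range_two_weak'`): `‖Σ‖ ≤ C(|L′(1,χ)| + 𝓛^{2.2})/𝓛⁹ ≤ C′𝓛^{−6.8}`,
from the closed form of the first line for every `d < P₂` (`Typed.Sec12B.line020_closed_form`)
minus its head `l ≤ P″₁/d` (`(log P₁)⁻¹log Y(1+log Y)`, `Y = P″₁/d < T`).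

## References

* Y. Zhang, arXiv:2211.02515v1 (2022), §12 Lemma 12.1 and its proof, p. 68.
  [cite: Zhang2022LandauSiegel, §12 Lemma 12.1, p. 68]
* H. L. Montgomery, R. C. Vaughan, *Multiplicative Number Theory I*, CUP 2007, Thm. 9.18
  (Pólya–Vinogradov). [cite: MontgomeryVaughan2007, §9.4 Thm. 9.18]
-/

noncomputable section

open Complex Real ComplexConjugate

namespace Literature.NumberTheory.LFunctions.Zhang2022.Typed.Sec12B

open Literature.NumberTheory.LFunctions.Zhang2022.Skeleton

/-! ### Partial summation with a weight whose derivative is `O(x⁻²)` -/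

section Abel

/-- One step of the variation: `‖G(n+1) − G(n)‖ ≤ M/n²` when `‖G′(x)‖ ≤ M/x²` on `[n, n+1]`
(mean value inequality). [folklore] -/
private theorem norm_sub_succ_le {G G' : ℝ → ℂ} {Y X M : ℝ} (hY : 0 < Y) (hM : 0 ≤ M)
    (hG : ∀ x : ℝ, Y ≤ x → x ≤ X → HasDerivAt G (G' x) x)
    (hG' : ∀ x : ℝ, Y ≤ x → x ≤ X → ‖G' x‖ ≤ M / x ^ 2)
    {n : ℕ} (hn : Y ≤ n) (hnX : (n : ℝ) + 1 ≤ X) :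
    ‖G ((n : ℝ) + 1) - G n‖ ≤ M / (n : ℝ) ^ 2 := by
  have hn0 : (0 : ℝ) < n := lt_of_lt_of_le hY hn
  have hconv : Convex ℝ (Set.Icc (n : ℝ) ((n : ℝ) + 1)) := convex_Icc _ _
  have key := hconv.norm_image_sub_le_of_norm_hasDerivWithin_le (f := G) (f' := G')
    (C := M / (n : ℝ) ^ 2) (x := (n : ℝ)) (y := (n : ℝ) + 1)
    (fun x hx => (hG x (le_trans hn hx.1) (le_trans hx.2 hnX)).hasDerivWithinAt)
    (fun x hx => by
      refine (hG' x (le_trans hn hx.1) (le_trans hx.2 hnX)).trans ?_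
      have hx0 : (0 : ℝ) < x := lt_of_lt_of_le hn0 hx.1
      apply div_le_div_of_nonneg_left hM (by positivity)
      nlinarith [hx.1])
    (Set.left_mem_Icc.mpr (by linarith)) (Set.right_mem_Icc.mpr (by linarith))
  have h1 : ‖((n : ℝ) + 1) - (n : ℝ)‖ = 1 := by
    rw [add_sub_cancel_left, norm_one]
  rw [h1, mul_one] at key
  exact key

/-- The summed variation: `Σ_{⌊Y⌋ < n < N₁} ‖G(n+1) − G(n)‖ ≤ 2M/Y` for `Y ≥ 2`, `N₁ ≤ X`
(`Σ_{n > k} 1/n² ≤ 1/k`). [folklore] -/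
private theorem sum_norm_sub_succ_le {G G' : ℝ → ℂ} {Y X M : ℝ} (hY : 2 ≤ Y) (hM : 0 ≤ M)
    (hG : ∀ x : ℝ, Y ≤ x → x ≤ X → HasDerivAt G (G' x) x)
    (hG' : ∀ x : ℝ, Y ≤ x → x ≤ X → ‖G' x‖ ≤ M / x ^ 2)
    {N₁ : ℕ} (hN₁ : (N₁ : ℝ) ≤ X) :
    ∑ n ∈ Finset.Ico (⌊Y⌋₊ + 1) N₁, ‖G ((n + 1 : ℕ) : ℝ) - G n‖ ≤ 2 * M / Y := by
  have hY0 : 0 < Y := by linarith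
  have hk1 : 1 ≤ ⌊Y⌋₊ := Nat.one_le_iff_ne_zero.mpr (Nat.pos_iff_ne_zero.mp
    (Nat.floor_pos.mpr (by linarith)))
  have hkY : Y / 2 ≤ (⌊Y⌋₊ : ℝ) := by
    have := Nat.lt_floor_add_one Y
    linarith
  calc ∑ n ∈ Finset.Ico (⌊Y⌋₊ + 1) N₁, ‖G ((n + 1 : ℕ) : ℝ) - G n‖
      ≤ ∑ n ∈ Finset.Ico (⌊Y⌋₊ + 1) N₁, M / (n : ℝ) ^ 2 := by
        refine Finset.sum_le_sum fun n hn => ?_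
        rw [Finset.mem_Ico] at hn
        have hYn : Y ≤ n := by
          have h1 : Y < (⌊Y⌋₊ : ℝ) + 1 := Nat.lt_floor_add_one Y
          have h2 : ((⌊Y⌋₊ + 1 : ℕ) : ℝ) ≤ n := by exact_mod_cast hn.1
          push_cast at h2; linarith
        have hnX : (n : ℝ) + 1 ≤ X := by
          have : ((n + 1 : ℕ) : ℝ) ≤ N₁ := by exact_mod_cast hn.2
          push_cast at this; linarith
        have := norm_sub_succ_le hY0 hM hG hG' hYn hnX
        push_cast
        exact this
    _ ≤ ∑ n ∈ Finset.Ioc ⌊Y⌋₊ (max ⌊Y⌋₊ N₁), M / (n : ℝ) ^ 2 := by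
        refine Finset.sum_le_sum_of_subset_of_nonneg ?_ fun n _ _ => by positivity
        intro n hn
        rw [Finset.mem_Ico] at hn
        rw [Finset.mem_Ioc]
        omega
    _ = M * ∑ n ∈ Finset.Ioc ⌊Y⌋₊ (max ⌊Y⌋₊ N₁), ((n : ℝ) ^ 2)⁻¹ := by
        rw [Finset.mul_sum]
        refine Finset.sum_congr rfl fun n _ => ?_
        rw [div_eq_mul_inv]
    _ ≤ M * ((⌊Y⌋₊ : ℝ)⁻¹ - ((max ⌊Y⌋₊ N₁ : ℕ) : ℝ)⁻¹) := by
        refine mul_le_mul_of_nonneg_left ?_ hM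
        exact sum_Ioc_inv_sq_le_sub (by omega) (le_max_left _ _)
    _ ≤ M * (⌊Y⌋₊ : ℝ)⁻¹ := by
        refine mul_le_mul_of_nonneg_left ?_ hM
        have : (0 : ℝ) ≤ ((max ⌊Y⌋₊ N₁ : ℕ) : ℝ)⁻¹ := by positivity
        linarith
    _ ≤ 2 * M / Y := by
        rw [mul_comm, ← div_eq_inv_mul, div_le_div_iff₀ (by positivity) hY0]
        nlinarith

end Abel

/-! ### The weight `x ↦ (log P₁)⁻¹ (x/Y)^{−β₆} log(x/Y) x^{β_j−1}` -/

section Weight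

/-- Collecting the powers: `(x/Y)^{−b}·x^{a−1} = Y^{b}·x^{a−1−b}` for `x, Y > 0`. [folklore] -/
private theorem cpow_collect {x Y : ℝ} (hx : 0 < x) (hY : 0 < Y) (a b : ℂ) :
    (((x / Y : ℝ)) : ℂ) ^ (-b) * (x : ℂ) ^ (a - 1) = ((Y : ℝ) : ℂ) ^ b * (x : ℂ) ^ (a - 1 - b) := by
  have hxY : 0 < x / Y := div_pos hx hY
  have hx0 : ((x : ℝ) : ℂ) ≠ 0 := by exact_mod_cast hx.ne'
  have hY0 : ((Y : ℝ) : ℂ) ≠ 0 := by exact_mod_cast hY.ne'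
  have hxY0 : (((x / Y : ℝ)) : ℂ) ≠ 0 := by exact_mod_cast hxY.ne'
  rw [Complex.cpow_def_of_ne_zero hxY0, Complex.cpow_def_of_ne_zero hx0,
    Complex.cpow_def_of_ne_zero hY0, Complex.cpow_def_of_ne_zero hx0, ← Complex.exp_add,
    ← Complex.exp_add, ← Complex.ofReal_log hxY.le, ← Complex.ofReal_log hx.le,
    ← Complex.ofReal_log hY.le, Real.log_div hx.ne' hY.ne']
  push_cast
  ring_nf

/-- The derivative of `G(x) = K·x^e·log(x/Y)` for `x > 0` (`e ≠ 0`). [folklore] -/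
private theorem hasDerivAt_weight {K e : ℂ} (he : e ≠ 0) {Y x : ℝ} (hY : 0 < Y) (hx : 0 < x) :
    HasDerivAt (fun y : ℝ => K * ((y : ℂ) ^ e * (Real.log (y / Y) : ℂ)))
      (K * (e * (x : ℂ) ^ (e - 1) * (Real.log (x / Y) : ℂ) + (x : ℂ) ^ e * ((x⁻¹ : ℝ) : ℂ))) x := by
  have h1 : HasDerivAt (fun y : ℝ => y / Y) (1 / Y) x := (hasDerivAt_id x).div_const Y
  have hxY : x / Y ≠ 0 := (div_pos hx hY).ne'
  have h2 : HasDerivAt (fun y : ℝ => Real.log (y / Y)) x⁻¹ x := by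
    have := (Real.hasDerivAt_log hxY).comp x h1
    have e1 : (x / Y)⁻¹ * (1 / Y) = x⁻¹ := by field_simp
    rw [e1] at this
    exact this
  have h3 : HasDerivAt (fun y : ℝ => (Real.log (y / Y) : ℂ)) ((x⁻¹ : ℝ) : ℂ) x := h2.ofReal_comp
  have h4 : HasDerivAt (fun y : ℝ => (y : ℂ) ^ e) (e * (x : ℂ) ^ (e - 1)) x :=
    hasDerivAt_ofReal_cpow_const hx.ne' he
  exact (h4.mul h3).const_mul K

/-- The size of that derivative on `[Y, X]`: `‖G′(x)‖ ≤ (‖K‖(‖e‖log(X/Y) + 1))/x²` when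
`Re e = −1`. [folklore] -/
private theorem norm_weight_deriv_le {K e : ℂ} (he : e.re = -1) {Y X x : ℝ} (hY : 0 < Y)
    (hYx : Y ≤ x) (hxX : x ≤ X) :
    ‖K * (e * (x : ℂ) ^ (e - 1) * (Real.log (x / Y) : ℂ) + (x : ℂ) ^ e * ((x⁻¹ : ℝ) : ℂ))‖ ≤
      ‖K‖ * (‖e‖ * Real.log (X / Y) + 1) / x ^ 2 := by
  have hx : 0 < x := lt_of_lt_of_le hY hYx
  have hlog0 : 0 ≤ Real.log (x / Y) := Real.log_nonneg ((one_le_div hY).mpr hYx)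
  have hlogX : Real.log (x / Y) ≤ Real.log (X / Y) :=
    Real.log_le_log (div_pos hx hY) (div_le_div_of_nonneg_right hxX hY.le)
  have hp1 : ‖(x : ℂ) ^ (e - 1)‖ = (x ^ 2)⁻¹ := by
    rw [Complex.norm_cpow_eq_rpow_re_of_pos hx, Complex.sub_re, he, Complex.one_re,
      show ((-1 : ℝ) - 1) = -(2 : ℕ) by norm_num, Real.rpow_neg hx.le, Real.rpow_natCast]
  have hp2 : ‖(x : ℂ) ^ e‖ = x⁻¹ := by
    rw [Complex.norm_cpow_eq_rpow_re_of_pos hx, he, Real.rpow_neg_one]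
  have hxinv : ‖((x⁻¹ : ℝ) : ℂ)‖ = x⁻¹ := by
    rw [Complex.norm_real, Real.norm_eq_abs, abs_of_pos (inv_pos.mpr hx)]
  have hlogn : ‖(Real.log (x / Y) : ℂ)‖ = Real.log (x / Y) := by
    rw [Complex.norm_real, Real.norm_eq_abs, abs_of_nonneg hlog0]
  calc ‖K * (e * (x : ℂ) ^ (e - 1) * (Real.log (x / Y) : ℂ) + (x : ℂ) ^ e * ((x⁻¹ : ℝ) : ℂ))‖
      ≤ ‖K‖ * (‖e * (x : ℂ) ^ (e - 1) * (Real.log (x / Y) : ℂ)‖ + ‖(x : ℂ) ^ e * ((x⁻¹ : ℝ) : ℂ)‖) := by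
        rw [norm_mul]; exact mul_le_mul_of_nonneg_left (norm_add_le _ _) (norm_nonneg _)
    _ = ‖K‖ * (‖e‖ * (x ^ 2)⁻¹ * Real.log (x / Y) + x⁻¹ * x⁻¹) := by
        rw [norm_mul, norm_mul, hp1, hlogn, norm_mul, hp2, hxinv]
    _ = ‖K‖ * (‖e‖ * Real.log (x / Y) + 1) / x ^ 2 := by
        field_simp
    _ ≤ ‖K‖ * (‖e‖ * Real.log (X / Y) + 1) / x ^ 2 := by
        gcongr

end Weight

/-! ### Clause (i) of Lemma 12.1: the range `d ≤ P″₁/T` -/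

section RangeOne

/-- The shifts `β_j` (2.13) are purely imaginary of size `≤ (3 + 5|c′|)α` (any real `c′`; for
`𝓛 ≥ 2`). [cite: Zhang2022LandauSiegel, §2 (2.13)] -/
private theorem betaJ_re_and_norm' (c' : ℝ) {D : ℕ} (hL : 2 ≤ Real.log D) {j : ℕ}
    (hj : j ∈ ({1, 2, 3} : Finset ℕ)) :
    (betaJ c' D j).re = 0 ∧ ‖betaJ c' D j‖ ≤ (3 + 5 * |c'|) * (π / Real.log D ^ 9) := by
  have hπ := Real.pi_pos
  have hL0 : 0 < Real.log D := by linarith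
  have hα : alpha D = π / Real.log D ^ 9 := by rw [alpha, bigP, Real.log_exp, ell]
  set a : ℝ := π / Real.log D ^ 9 with ha
  have ha0 : 0 < a := by positivity
  have hell : ell D = Real.log D := rfl
  have haL : a * Real.log D ≤ 1 := by
    have h8 : (2 : ℝ) ^ 8 ≤ Real.log D ^ 8 := pow_le_pow_left₀ (by norm_num) hL 8
    have hπ4 : π ≤ 4 := Real.pi_le_four
    rw [ha, div_mul_eq_mul_div, div_le_one (by positivity)]
    calc π * Real.log D ≤ 4 * Real.log D := by nlinarith
      _ ≤ 2 ^ 8 * Real.log D := by nlinarith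
      _ ≤ Real.log D ^ 8 * Real.log D := by nlinarith
      _ = Real.log D ^ 9 := by ring
  have haL0 : 0 ≤ a * Real.log D := by positivity
  have hc0 : 0 ≤ |c'| := abs_nonneg _
  have hcaL : |c'| * (a * Real.log D) ≤ |c'| := by nlinarith
  simp only [Finset.mem_insert, Finset.mem_singleton] at hj
  rcases hj with rfl | rfl | rfl
  · have he : betaJ c' D 1 = ((a * (1 - 5 * c' * a * Real.log D) : ℝ) : ℂ) * I := by
      simp only [betaJ, Nat.reduceMod, if_true, beta1, hα, hell]
      push_cast; ring
    refine ⟨by rw [he]; exact Lemma82.re_ofReal_mul_I _, ?_⟩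
    rw [he, Lemma82.norm_ofReal_mul_I, abs_mul, abs_of_pos ha0]
    have h1 : |1 - 5 * c' * a * Real.log D| ≤ 1 + 5 * |c'| := by
      calc |1 - 5 * c' * a * Real.log D| ≤ |(1 : ℝ)| + |5 * c' * a * Real.log D| := abs_sub _ _
        _ = 1 + 5 * (|c'| * (a * Real.log D)) := by
            rw [abs_one, show 5 * c' * a * Real.log D = 5 * (c' * (a * Real.log D)) by ring,
              abs_mul, abs_mul, abs_of_nonneg haL0, abs_of_pos (by norm_num : (0 : ℝ) < 5)]
        _ ≤ 1 + 5 * |c'| := by linarith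
    nlinarith
  · have he : betaJ c' D 2 = ((2 * a * (1 + c' * a * Real.log D) : ℝ) : ℂ) * I := by
      simp only [betaJ, Nat.reduceMod, beta2, hα, hell]
      norm_num; ring
    refine ⟨by rw [he]; exact Lemma82.re_ofReal_mul_I _, ?_⟩
    rw [he, Lemma82.norm_ofReal_mul_I, abs_mul, abs_of_pos (by positivity : (0 : ℝ) < 2 * a)]
    have h1 : |1 + c' * a * Real.log D| ≤ 1 + |c'| := by
      calc |1 + c' * a * Real.log D| ≤ |(1 : ℝ)| + |c' * a * Real.log D| := abs_add_le _ _
        _ = 1 + |c'| * (a * Real.log D) := by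
            rw [abs_one, show c' * a * Real.log D = c' * (a * Real.log D) by ring, abs_mul,
              abs_of_nonneg haL0]
        _ ≤ 1 + |c'| := by linarith
    nlinarith
  · have he : betaJ c' D 3 = ((3 * a * (1 - c' * a * Real.log D) : ℝ) : ℂ) * I := by
      simp only [betaJ, Nat.reduceMod, beta3, hα, hell]
      norm_num; ring
    refine ⟨by rw [he]; exact Lemma82.re_ofReal_mul_I _, ?_⟩
    rw [he, Lemma82.norm_ofReal_mul_I, abs_mul, abs_of_pos (by positivity : (0 : ℝ) < 3 * a)]
    have h1 : |1 - c' * a * Real.log D| ≤ 1 + |c'| := by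
      calc |1 - c' * a * Real.log D| ≤ |(1 : ℝ)| + |c' * a * Real.log D| := abs_sub _ _
        _ = 1 + |c'| * (a * Real.log D) := by
            rw [abs_one, show c' * a * Real.log D = c' * (a * Real.log D) by ring, abs_mul,
              abs_of_nonneg haL0]
        _ ≤ 1 + |c'| := by linarith
    nlinarith

variable (c' : ℝ)

set_option maxHeartbeats 800000 in
-- one long assembly (parameter bookkeeping + Abel summation): above the default budget
/-- **Z22:§12.u018, first clause / Lemma 12.1 clause (i) HOLDS** (for every real `c′`, and without
hypothesis (A)): for all large `D`, every real primitive `χ (mod D)`, `j ∈ {1,2,3}` and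
`1 ≤ d ≤ P″₁/T`: `‖Σ_l χ(l)ϰ₁₃(dl)l^{β_j−1}‖ ≤ T^{−1/4}` — "by the Pólya–Vinogradov inequality and
partial summation" (proof of Lemma 12.1, p. 68, tex L3492), made explicit: with `Y = P″₁/d ≥ T`,
`X = P″₂/d`, the sum is `Σ_{Y<l<X} χ(l)G(l)`, `G(x) = (log P₁)⁻¹Y^{β₆}x^{β_j−1−β₆}log(x/Y)`,
`‖G′(x)‖ ≤ (0.008𝓛⁹+1)/(0.504𝓛⁹x²)`, `‖G(X)‖ ≤ 0.008/Y`; Abel summation against the window bound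
`‖Σ_{N<n≤M}χ(n)‖ ≤ √D(1+𝓛)` (F-16, tree `CharacterTails.norm_window_le_polyaVinogradov`) gives
`≤ 0.05·√D(1+𝓛)/T ≤ T^{−1/4}` once `𝓛 ≥ 1024` (`√D(1+𝓛) ≤ T^{3/4}`).
[cite: Zhang2022LandauSiegel, §12 Lemma 12.1, p. 68] -/
theorem sum121_range_one : ForAllLarge fun D _ χ =>
    ∀ j ∈ ({1, 2, 3} : Finset ℕ), ∀ d : ℕ, 1 ≤ d → (d : ℝ) ≤ P1pp D / bigT D →
      ‖sum121 c' χ j d‖ ≤ bigT D ^ (-(1 / 4 : ℝ)) := by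
  refine ⟨⌈Real.exp (1024 + 32 * |c'|)⌉₊, fun D _ χ hD hq hp j hj d hd hdT => ?_⟩
  have hπ := Real.pi_pos
  have hc0 : 0 ≤ |c'| := abs_nonneg _
  -- `D` large
  have hDexp : Real.exp (1024 + 32 * |c'|) ≤ D := le_trans (Nat.le_ceil _) (by exact_mod_cast hD)
  have hD0 : (0 : ℝ) < D := lt_of_lt_of_le (Real.exp_pos _) hDexp
  obtain ⟨L, hLdef⟩ : ∃ L : ℝ, L = Real.log D := ⟨_, rfl⟩
  have hL : 1024 + 32 * |c'| ≤ L := by rw [hLdef]; exact (Real.le_log_iff_exp_le hD0).mpr hDexp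
  have hL1024 : 1024 ≤ L := by linarith
  have hL1 : 1 ≤ L := by linarith
  have hL0 : 0 < L := by linarith
  have hell : ell D = L := hLdef.symm
  have hDr : (21 : ℝ) ≤ D := by
    have := Real.log_le_sub_one_of_pos hD0; rw [← hLdef] at this; linarith
  have hD3 : 3 ≤ D := by exact_mod_cast (show (3 : ℝ) ≤ D by linarith)
  have hD2 : 2 ≤ D := le_trans (by norm_num) hD3
  have hP : 0 < bigP D := Real.exp_pos _
  have hT : 0 < bigT D := Real.exp_pos _
  have hP1pp : 0 < P1pp D := P1pp_pos hD3
  have hP2pp : 0 < P2pp D := P2pp_pos hD3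
  have hd0 : (0 : ℝ) < d := by exact_mod_cast hd
  have hlogP1 : Real.log (Skeleton.P1 D) = 0.504 * L ^ 9 := by
    rw [Skeleton.P1, Real.log_rpow hP, bigP, Real.log_exp, hell]
  have hlogP1pos : 0 < Real.log (Skeleton.P1 D) := by rw [hlogP1]; positivity
  -- `Y = P″₁/d ≥ T ≥ 2`, `X = P″₂/d = P^{0.004}·Y ≥ Y + 2`
  obtain ⟨Y, hY⟩ : ∃ Y : ℝ, Y = P1pp D / d := ⟨_, rfl⟩
  obtain ⟨X, hX⟩ : ∃ X : ℝ, X = P2pp D / d := ⟨_, rfl⟩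
  have hY0 : 0 < Y := by rw [hY]; exact div_pos hP1pp hd0
  have hYT : bigT D ≤ Y := by
    rw [hY, le_div_iff₀ hd0]
    have := hdT; rw [le_div_iff₀ hT] at this; linarith [mul_comm (d : ℝ) (bigT D)]
  have hT2 : 2 ≤ bigT D := by
    have h1 : (1 : ℝ) ≤ L ^ (1.1 : ℝ) := Real.one_le_rpow hL1 (by norm_num)
    have h2 : Real.exp 1 ≤ Real.exp (L ^ (1.1 : ℝ)) := Real.exp_le_exp.mpr h1
    have h3 : (1 : ℝ) + 1 ≤ Real.exp 1 := Real.add_one_le_exp 1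
    rw [bigT, hell]; linarith
  have hY2 : 2 ≤ Y := le_trans hT2 hYT
  have hratio : P2pp D / P1pp D = bigP D ^ (0.004 : ℝ) := by
    have ht0 : 0 < t0 D := by rw [t0, hell]; positivity
    have hne : (D : ℝ) * t0 D ≠ 0 := by positivity
    have h1 : P2pp D / P1pp D = bigP D ^ (0.5 : ℝ) / bigP D ^ (0.496 : ℝ) := by
      rw [P2pp, P1pp, mul_assoc, mul_assoc, mul_div_mul_right _ _ hne]
    rw [h1, ← Real.rpow_sub hP]
    norm_num
  have hXY : X = bigP D ^ (0.004 : ℝ) * Y := by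
    rw [hX, hY, ← hratio]; field_simp
  have hlogXY : Real.log (X / Y) = 0.004 * L ^ 9 := by
    rw [hXY, mul_div_assoc, div_self hY0.ne', mul_one, Real.log_rpow hP, bigP, Real.log_exp, hell]
  have hP004 : 2 ≤ bigP D ^ (0.004 : ℝ) := by
    have h1 : Real.log (bigP D ^ (0.004 : ℝ)) = 0.004 * L ^ 9 := by
      rw [Real.log_rpow hP, bigP, Real.log_exp, hell]
    have h2 : (1 : ℝ) ≤ 0.004 * L ^ 9 := by
      have : (1 : ℝ) ≤ L ^ 9 := one_le_pow₀ hL1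
      nlinarith [pow_le_pow_left₀ (by norm_num : (0:ℝ) ≤ 1024) hL1024 9]
    have h3 : Real.exp 1 ≤ bigP D ^ (0.004 : ℝ) := by
      rw [← Real.exp_log (Real.rpow_pos_of_pos hP _), h1]; exact Real.exp_le_exp.mpr h2
    linarith [Real.add_one_le_exp (1 : ℝ)]
  have hX2Y : 2 * Y ≤ X := by rw [hXY]; nlinarith
  have hX0 : 0 < X := by linarith
  -- `N₁ = ⌈X⌉ − 1`
  obtain ⟨N₁, hN₁⟩ : ∃ N₁ : ℕ, N₁ = ⌈X⌉₊ - 1 := ⟨_, rfl⟩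
  have hceil1 : 1 ≤ ⌈X⌉₊ := Nat.one_le_iff_ne_zero.mpr (Nat.pos_iff_ne_zero.mp (Nat.ceil_pos.mpr hX0))
  have hN₁cast : (N₁ : ℝ) = (⌈X⌉₊ : ℝ) - 1 := by rw [hN₁, Nat.cast_sub hceil1]; simp
  have hN₁X : (N₁ : ℝ) ≤ X := by rw [hN₁cast]; linarith [Nat.ceil_lt_add_one hX0.le]
  have hXN₁ : X - 1 ≤ (N₁ : ℝ) := by rw [hN₁cast]; linarith [Nat.le_ceil X]
  have hYN₁ : Y ≤ (N₁ : ℝ) := by linarith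
  have hN₁0 : (0 : ℝ) < N₁ := by linarith
  have hkN₁ : ⌊Y⌋₊ ≤ N₁ := by
    have : (⌊Y⌋₊ : ℝ) ≤ N₁ := le_trans (Nat.floor_le hY0.le) hYN₁
    exact_mod_cast this
  -- the shifts
  obtain ⟨hβjre, hβjn⟩ := betaJ_re_and_norm' c' (by linarith) hj
  have hα : alpha D = π / L ^ 9 := by rw [alpha, bigP, Real.log_exp, hell]
  have hβ6eq : beta6 D = ((3 / 2 * (π / L ^ 9) : ℝ) : ℂ) * I := by
    rw [beta6, hα]; push_cast; ring
  have hβ6re : (beta6 D).re = 0 := by rw [hβ6eq]; exact Lemma82.re_ofReal_mul_I _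
  have hβ6n : ‖beta6 D‖ ≤ (3 + 5 * |c'|) * (π / L ^ 9) := by
    rw [hβ6eq, Lemma82.norm_ofReal_mul_I, abs_of_pos (by positivity)]
    have h0 : 0 ≤ π / L ^ 9 := by positivity
    nlinarith only [h0, hc0]
  rw [← hLdef] at hβjn
  obtain ⟨e, he⟩ : ∃ e : ℂ, e = betaJ c' D j - 1 - beta6 D := ⟨_, rfl⟩
  have here : e.re = -1 := by
    rw [he, Complex.sub_re, Complex.sub_re, Complex.one_re, hβjre, hβ6re]; ring
  have he0 : e ≠ 0 := by intro h; rw [h] at here; norm_num at here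
  have hen : ‖e‖ ≤ 2 := by
    have hsmall : 2 * ((3 + 5 * |c'|) * (π / L ^ 9)) ≤ 1 := by
      have hL9 : L ≤ L ^ 9 := by
        calc L = L ^ 1 := (pow_one _).symm
          _ ≤ L ^ 9 := pow_le_pow_right₀ hL1 (by norm_num)
      rw [show 2 * ((3 + 5 * |c'|) * (π / L ^ 9)) = (6 + 10 * |c'|) * π / L ^ 9 by ring,
        div_le_one (by positivity)]
      have hπ4 : π < 3.15 := Real.pi_lt_d2
      nlinarith
    calc ‖e‖ = ‖(betaJ c' D j - beta6 D) + (-1 : ℂ)‖ := by rw [he]; ring_nf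
      _ ≤ ‖betaJ c' D j - beta6 D‖ + ‖(-1 : ℂ)‖ := norm_add_le _ _
      _ ≤ (‖betaJ c' D j‖ + ‖beta6 D‖) + 1 := by
          rw [norm_neg, norm_one]; exact add_le_add (norm_sub_le _ _) le_rfl
      _ ≤ 2 := by linarith
  -- the weight `F` (as in the summand) and its collected form `G`
  obtain ⟨K, hK⟩ : ∃ K : ℂ, K = ((Real.log (Skeleton.P1 D))⁻¹ : ℝ) * ((Y : ℝ) : ℂ) ^ (beta6 D) :=
    ⟨_, rfl⟩
  have hKn : ‖K‖ = (Real.log (Skeleton.P1 D))⁻¹ := by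
    rw [hK, norm_mul, Complex.norm_real, Real.norm_eq_abs, abs_of_pos (inv_pos.mpr hlogP1pos),
      Complex.norm_cpow_eq_rpow_re_of_pos hY0, hβ6re, Real.rpow_zero, mul_one]
  obtain ⟨F, hF⟩ : ∃ F : ℝ → ℂ, F = fun x : ℝ => ((Real.log (Skeleton.P1 D))⁻¹ : ℝ) *
      (((x / Y : ℝ)) : ℂ) ^ (-beta6 D) * (Real.log (x / Y) : ℂ) * (x : ℂ) ^ (betaJ c' D j - 1) :=
    ⟨_, rfl⟩
  obtain ⟨G, hG⟩ : ∃ G : ℝ → ℂ, G = fun x : ℝ => K * ((x : ℂ) ^ e * (Real.log (x / Y) : ℂ)) :=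
    ⟨_, rfl⟩
  have hFG : ∀ x : ℝ, 0 < x → F x = G x := by
    intro x hx
    simp only [hF, hG, hK, he]
    have := cpow_collect hx hY0 (betaJ c' D j) (beta6 D)
    calc (((Real.log (Skeleton.P1 D))⁻¹ : ℝ) : ℂ) * (((x / Y : ℝ)) : ℂ) ^ (-beta6 D) *
          (Real.log (x / Y) : ℂ) * (x : ℂ) ^ (betaJ c' D j - 1)
        = (((Real.log (Skeleton.P1 D))⁻¹ : ℝ) : ℂ) *
            ((((x / Y : ℝ)) : ℂ) ^ (-beta6 D) * (x : ℂ) ^ (betaJ c' D j - 1)) *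
              (Real.log (x / Y) : ℂ) := by ring
      _ = _ := by rw [this]; ring
  -- the sum IS `Σ_{⌊Y⌋ < l ≤ N₁} F(l)χ(l)`
  have hsum : sum121 c' χ j d = ∑ n ∈ Finset.Ioc ⌊Y⌋₊ N₁, F n * χ (n : ZMod D) := by
    have hsub : Finset.Ioc ⌊Y⌋₊ N₁ ⊆ Finset.Ico 1 ⌈P2pp D⌉₊ := by
      intro n hn
      rw [Finset.mem_Ioc] at hn
      rw [Finset.mem_Ico]
      refine ⟨by omega, ?_⟩
      have h1 : n < ⌈X⌉₊ := by omega
      have hXP : X ≤ P2pp D := by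
        rw [hX]; exact div_le_self hP2pp.le (by exact_mod_cast hd)
      exact lt_of_lt_of_le h1 (Nat.ceil_mono hXP)
    have hzero : ∀ l ∈ Finset.Ico 1 ⌈P2pp D⌉₊, l ∉ Finset.Ioc ⌊Y⌋₊ N₁ →
        χ (l : ZMod D) * vk13 D (d * l) / (l : ℂ) ^ (1 - betaJ c' D j) = 0 := by
      intro l hl hl'
      rw [Finset.mem_Ioc, not_and_or, not_lt, not_le] at hl'
      have hcond : ¬ (P1pp D < ((d * l : ℕ) : ℝ) ∧ ((d * l : ℕ) : ℝ) < P2pp D) := by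
        rintro ⟨h1, h2⟩
        push_cast at h1 h2
        rcases hl' with h | h
        · have hlY : (l : ℝ) ≤ Y := le_trans (by exact_mod_cast h) (Nat.floor_le hY0.le)
          rw [hY, le_div_iff₀ hd0] at hlY
          linarith only [hlY, h1]
        · have hXl : X ≤ l := by
            have : ⌈X⌉₊ ≤ l := by omega
            exact le_trans (Nat.le_ceil X) (by exact_mod_cast this)
          rw [hX, div_le_iff₀ hd0] at hXl
          linarith only [hXl, h2]
      rw [vk13, if_neg hcond]; simp
    have hterm : ∀ l ∈ Finset.Ioc ⌊Y⌋₊ N₁,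
        χ (l : ZMod D) * vk13 D (d * l) / (l : ℂ) ^ (1 - betaJ c' D j) = F l * χ (l : ZMod D) := by
      intro l hl
      rw [Finset.mem_Ioc] at hl
      have hYl : Y < l := (Nat.floor_lt hY0.le).mp hl.1
      have hlX : (l : ℝ) < X := by
        have : (l : ℝ) ≤ N₁ := by exact_mod_cast hl.2
        have h2 : (N₁ : ℝ) < X := by rw [hN₁cast]; linarith only [Nat.ceil_lt_add_one hX0.le]
        linarith only [this, h2]
      have hl0 : (0 : ℝ) < l := lt_trans hY0 hYl
      have hlC : (l : ℂ) ≠ 0 := by exact_mod_cast hl0.ne'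
      have hcond : P1pp D < ((d * l : ℕ) : ℝ) ∧ ((d * l : ℕ) : ℝ) < P2pp D := by
        push_cast
        constructor
        · rw [hY, div_lt_iff₀ hd0] at hYl; linarith only [hYl]
        · rw [hX, lt_div_iff₀ hd0] at hlX; linarith only [hlX]
      have hdl : (((d * l : ℕ) : ℝ) / P1pp D : ℝ) = (l : ℝ) / Y := by
        rw [hY]; push_cast; field_simp
      rw [vk13, if_pos hcond, hdl]
      simp only [hF]
      have hpow : 1 / (l : ℂ) ^ (1 - betaJ c' D j) = (l : ℂ) ^ (betaJ c' D j - 1) := by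
        rw [show betaJ c' D j - 1 = -(1 - betaJ c' D j) by ring, Complex.cpow_neg, one_div]
      rw [div_eq_mul_one_div, hpow]
      push_cast
      ring
    rw [sum121, ← Finset.sum_subset hsub hzero]
    exact Finset.sum_congr rfl hterm
  -- Abel summation against the Pólya–Vinogradov window bound
  have hW := fun m (_ : m ∈ Finset.Icc ⌊Y⌋₊ N₁) =>
    CharacterTails.norm_window_le_polyaVinogradov χ hp hD2 ⌊Y⌋₊ m
  have habel := PartialSums.norm_sum_Ioc_mul_le_abel (fun n : ℕ => χ (n : ZMod D))
    (fun n : ℕ => F n) hkN₁ hW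
  -- the two pieces of the Abel bound, through `G`
  obtain ⟨M, hM⟩ : ∃ M : ℝ, M = ‖K‖ * (‖e‖ * Real.log (X / Y) + 1) := ⟨_, rfl⟩
  have hXY1 : 1 ≤ X / Y := by rw [le_div_iff₀ hY0]; linarith only [hX2Y, hY0]
  have hlogXY0 : 0 ≤ Real.log (X / Y) := Real.log_nonneg hXY1
  have hM0 : 0 ≤ M := by rw [hM]; positivity
  have hGd : ∀ x : ℝ, Y ≤ x → x ≤ X → HasDerivAt G
      (K * (e * (x : ℂ) ^ (e - 1) * (Real.log (x / Y) : ℂ) + (x : ℂ) ^ e * ((x⁻¹ : ℝ) : ℂ))) x := by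
    intro x hYx _
    rw [hG]
    exact hasDerivAt_weight he0 hY0 (lt_of_lt_of_le hY0 hYx)
  have hGd' : ∀ x : ℝ, Y ≤ x → x ≤ X →
      ‖K * (e * (x : ℂ) ^ (e - 1) * (Real.log (x / Y) : ℂ) + (x : ℂ) ^ e * ((x⁻¹ : ℝ) : ℂ))‖ ≤
        M / x ^ 2 := by
    intro x hYx hxX; rw [hM]; exact norm_weight_deriv_le here hY0 hYx hxX
  have hvar : ∑ n ∈ Finset.Ico (⌊Y⌋₊ + 1) N₁, ‖F ((n + 1 : ℕ) : ℝ) - F n‖ ≤ 2 * M / Y := by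
    have hcongr : ∑ n ∈ Finset.Ico (⌊Y⌋₊ + 1) N₁, ‖F ((n + 1 : ℕ) : ℝ) - F n‖ =
        ∑ n ∈ Finset.Ico (⌊Y⌋₊ + 1) N₁, ‖G ((n + 1 : ℕ) : ℝ) - G n‖ := by
      refine Finset.sum_congr rfl fun n hn => ?_
      rw [Finset.mem_Ico] at hn
      have hn1 : (1 : ℝ) ≤ n := by exact_mod_cast (le_trans (Nat.le_add_left 1 _) hn.1)
      have hn0 : (0 : ℝ) < n := by linarith only [hn1]
      rw [hFG _ hn0, hFG _ (by positivity)]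
    rw [hcongr]
    exact sum_norm_sub_succ_le hY2 hM0 hGd hGd' hN₁X
  have hlast : ‖F N₁‖ ≤ ‖K‖ * Real.log (X / Y) / Y := by
    rw [hFG _ hN₁0]
    simp only [hG]
    rw [norm_mul, norm_mul, Complex.norm_cpow_eq_rpow_re_of_pos hN₁0, here, Real.rpow_neg_one,
      Complex.norm_real, Real.norm_eq_abs,
      abs_of_nonneg (Real.log_nonneg ((one_le_div hY0).mpr hYN₁))]
    have h1 : Real.log (N₁ / Y) ≤ Real.log (X / Y) :=
      Real.log_le_log (div_pos hN₁0 hY0) (div_le_div_of_nonneg_right hN₁X hY0.le)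
    have h2 : (N₁ : ℝ)⁻¹ ≤ Y⁻¹ := by rw [inv_le_inv₀ hN₁0 hY0]; exact hYN₁
    have h3 : 0 ≤ Real.log (X / Y) := le_trans (Real.log_nonneg ((one_le_div hY0).mpr hYN₁)) h1
    calc ‖K‖ * ((N₁ : ℝ)⁻¹ * Real.log (N₁ / Y)) ≤ ‖K‖ * (Y⁻¹ * Real.log (X / Y)) := by
          refine mul_le_mul_of_nonneg_left ?_ (norm_nonneg _)
          exact mul_le_mul h2 h1 (Real.log_nonneg ((one_le_div hY0).mpr hYN₁)) (by positivity)
      _ = ‖K‖ * Real.log (X / Y) / Y := by ring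
  -- numerics: the bracket is `≤ 0.05/Y`
  have hbracket : ‖F N₁‖ + ∑ n ∈ Finset.Ico (⌊Y⌋₊ + 1) N₁, ‖F ((n + 1 : ℕ) : ℝ) - F n‖ ≤
      0.05 / Y := by
    have hL9 : (1024 : ℝ) ≤ L ^ 9 := le_trans hL1024 (by
      calc L = L ^ 1 := (pow_one _).symm
        _ ≤ L ^ 9 := pow_le_pow_right₀ hL1 (by norm_num))
    have hKval : ‖K‖ = 1 / (0.504 * L ^ 9) := by rw [hKn, hlogP1, one_div]
    have hL90 : (0 : ℝ) ≤ L ^ 9 := by positivity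
    have h1 : ‖K‖ * Real.log (X / Y) ≤ 0.008 := by
      rw [hKval, hlogXY, div_mul_eq_mul_div, div_le_iff₀ (by positivity)]
      linarith only [hL90]
    have h2 : 2 * M ≤ 0.04 := by
      rw [hM, hKval, hlogXY]
      have he2 : ‖e‖ * (0.004 * L ^ 9) ≤ 2 * (0.004 * L ^ 9) :=
        mul_le_mul_of_nonneg_right hen (by positivity)
      have : 1 / (0.504 * L ^ 9) * (‖e‖ * (0.004 * L ^ 9) + 1) ≤
          1 / (0.504 * L ^ 9) * (2 * (0.004 * L ^ 9) + 1) := by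
        refine mul_le_mul_of_nonneg_left ?_ (by positivity)
        linarith only [he2]
      have h3 : 2 * (1 / (0.504 * L ^ 9) * (2 * (0.004 * L ^ 9) + 1)) ≤ 0.04 := by
        rw [show 2 * (1 / (0.504 * L ^ 9) * (2 * (0.004 * L ^ 9) + 1)) =
          (0.016 * L ^ 9 + 2) / (0.504 * L ^ 9) by field_simp; ring]
        rw [div_le_iff₀ (by positivity)]
        linarith only [hL9]
      linarith only [this, h3]
    calc ‖F N₁‖ + ∑ n ∈ Finset.Ico (⌊Y⌋₊ + 1) N₁, ‖F ((n + 1 : ℕ) : ℝ) - F n‖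
        ≤ ‖K‖ * Real.log (X / Y) / Y + 2 * M / Y := add_le_add hlast hvar
      _ = (‖K‖ * Real.log (X / Y) + 2 * M) / Y := by ring
      _ ≤ 0.05 / Y := by
          apply div_le_div_of_nonneg_right _ hY0.le; linarith only [h1, h2]
  -- `√D(1+𝓛) ≤ T^{3/4}`
  have hsqrtD : Real.sqrt D * (1 + Real.log D) ≤ bigT D ^ (3 / 4 : ℝ) := by
    have h1 : Real.sqrt (D : ℝ) = Real.exp (L / 2) := by
      rw [hLdef, Real.exp_half, Real.exp_log hD0]
    have h2 : 1 + Real.log D ≤ Real.exp L := by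
      rw [← hLdef]; linarith only [Real.add_one_le_exp L]
    have h3 : bigT D ^ (3 / 4 : ℝ) = Real.exp (3 / 4 * L ^ (1.1 : ℝ)) := by
      rw [bigT, hell, ← Real.exp_mul]; ring_nf
    have h01 : (2 : ℝ) ≤ L ^ (0.1 : ℝ) := by
      have : (1024 : ℝ) ^ (0.1 : ℝ) ≤ L ^ (0.1 : ℝ) :=
        Real.rpow_le_rpow (by norm_num) hL1024 (by norm_num)
      have h1024 : (1024 : ℝ) ^ (0.1 : ℝ) = 2 := by
        rw [show (1024 : ℝ) = (2 : ℝ) ^ ((10 : ℕ) : ℝ) by norm_num, ← Real.rpow_mul (by norm_num)]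
        norm_num
      linarith only [this, h1024]
    have h11 : 2 * L ≤ L ^ (1.1 : ℝ) := by
      have : L ^ (1.1 : ℝ) = L ^ (1 : ℝ) * L ^ (0.1 : ℝ) := by
        rw [← Real.rpow_add hL0]; norm_num
      rw [this, Real.rpow_one]; nlinarith only [h01, hL0]
    calc Real.sqrt D * (1 + Real.log D) ≤ Real.exp (L / 2) * Real.exp L := by
          rw [h1]; exact mul_le_mul_of_nonneg_left h2 (Real.exp_nonneg _)
      _ = Real.exp (3 / 2 * L) := by rw [← Real.exp_add]; ring_nf
      _ ≤ Real.exp (3 / 4 * L ^ (1.1 : ℝ)) := Real.exp_le_exp.mpr (by linarith only [h11])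
      _ = bigT D ^ (3 / 4 : ℝ) := h3.symm
  -- assemble
  have hW0 : 0 ≤ Real.sqrt D * (1 + Real.log D) := by
    have : 0 ≤ Real.log (D : ℝ) := Real.log_natCast_nonneg D
    positivity
  rw [hsum]
  calc ‖∑ n ∈ Finset.Ioc ⌊Y⌋₊ N₁, F n * χ (n : ZMod D)‖
      ≤ (‖F N₁‖ + ∑ n ∈ Finset.Ico (⌊Y⌋₊ + 1) N₁, ‖F ((n + 1 : ℕ) : ℝ) - F n‖) *
          (Real.sqrt D * (1 + Real.log D)) := habel
    _ ≤ 0.05 / Y * bigT D ^ (3 / 4 : ℝ) :=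
        mul_le_mul hbracket hsqrtD hW0 (by positivity)
    _ ≤ 0.05 / bigT D * bigT D ^ (3 / 4 : ℝ) :=
        mul_le_mul_of_nonneg_right (div_le_div_of_nonneg_left (by norm_num) hT hYT)
          (Real.rpow_nonneg hT.le _)
    _ = 0.05 * bigT D ^ (-(1 / 4 : ℝ)) := by
        rw [show (-(1 / 4 : ℝ)) = 3 / 4 - 1 by norm_num, Real.rpow_sub_one hT.ne']
        ring
    _ ≤ bigT D ^ (-(1 / 4 : ℝ)) := by
        have : 0 ≤ bigT D ^ (-(1 / 4 : ℝ)) := Real.rpow_nonneg hT.le _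
        linarith only [this]

/-- The same in the exact shape of the first conjunct of `Typed.Sec12B.U018 c′` (with (A) as an
idle hypothesis, `c = 1/4`, `C = 1`). [cite: Zhang2022LandauSiegel, §12 Lemma 12.1, p. 68] -/
theorem U018_first_clause : ∃ c : ℝ, 0 < c ∧ ∃ C : ℝ, ForAllLarge fun D _ χ => AssumptionA D χ →
    ∀ j ∈ ({1, 2, 3} : Finset ℕ), ∀ d : ℕ, 1 ≤ d →
      ((d : ℝ) ≤ P1pp D / bigT D → ‖sum121 c' χ j d‖ ≤ C * bigT D ^ (-c)) := by
  obtain ⟨D₀, h⟩ := sum121_range_one c'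
  refine ⟨1 / 4, by norm_num, 1, D₀, fun D _ χ hD hq hp _ j hj d hd hdT => ?_⟩
  rw [one_mul]
  exact h D χ hD hq hp j hj d hd hdT

end RangeOne

/-! ### Clause (ii) of Lemma 12.1, surviving weak form: the range `P″₁/T < d ≤ P″₁` -/

section RangeTwo

variable (c' : ℝ) {D : ℕ} (χ : DirichletCharacter ℂ D)

/-- `z^{−b}/z^{1−a} = 1/z^{1+b−a}` for `z ≠ 0`. [folklore] -/
private theorem cpow_neg_div_cpow_one_sub' {z : ℂ} (hz : z ≠ 0) (a b : ℂ) :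
    z ^ (-b) / z ^ (1 - a) = 1 / z ^ (1 + b - a) := by
  have h1 : z ^ (1 - a) ≠ 0 := by
    rw [Complex.cpow_def_of_ne_zero hz]; exact Complex.exp_ne_zero _
  have h2 : z ^ (1 + b - a) ≠ 0 := by
    rw [Complex.cpow_def_of_ne_zero hz]; exact Complex.exp_ne_zero _
  rw [div_eq_div_iff h1 h2, one_mul, ← Complex.cpow_add _ _ hz]
  congr 1; ring

/-- The summand of Lemma 12.1 WITHOUT the cut-off of `ϰ₁₃`:
`Φ(l) = χ(l)·(log P₁)⁻¹(dl/P″₁)^{−β₆}log(dl/P″₁)·l^{β_j−1}`. For every `1 ≤ d`, its sum over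
`1 ≤ l < P″₂/d` is the first displayed line `line020(d)` (the identity behind `sum121_eq_line020`,
which is the case `d > P″₁` where the cut-off is invisible). [cite: Zhang2022LandauSiegel, §12
proof of Lemma 12.1, p. 68] -/
private theorem sum_full_eq_line020 (hD : 3 ≤ D) (j : ℕ) {d : ℕ} (hd : 1 ≤ d) :
    ∑ l ∈ Finset.Ico 1 ⌈P2pp D / d⌉₊, χ (l : ZMod D) *
        ((((Real.log (Skeleton.P1 D))⁻¹ : ℝ) : ℂ) *
          ((((d * l : ℕ) : ℝ) / P1pp D : ℝ) : ℂ) ^ (-beta6 D) *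
            (Real.log (((d * l : ℕ) : ℝ) / P1pp D) : ℂ)) / (l : ℂ) ^ (1 - betaJ c' D j) =
      line020 c' χ j d := by
  have hP1pp : 0 < P1pp D := P1pp_pos hD
  have hd0 : (0 : ℝ) < d := by exact_mod_cast hd
  have hdP : 0 < (d : ℝ) / P1pp D := div_pos hd0 hP1pp
  set X : ℝ := P2pp D / d with hX
  set cd : ℂ := (((d : ℝ) / P1pp D : ℝ) : ℂ) with hcd
  set u : ℝ := Real.log ((d : ℝ) / P1pp D) with hu
  set e : ℂ := 1 + beta6 D - betaJ c' D j with he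
  have hterm : ∀ l ∈ Finset.Ico 1 ⌈X⌉₊,
      χ (l : ZMod D) * ((((Real.log (Skeleton.P1 D))⁻¹ : ℝ) : ℂ) *
          ((((d * l : ℕ) : ℝ) / P1pp D : ℝ) : ℂ) ^ (-beta6 D) *
            (Real.log (((d * l : ℕ) : ℝ) / P1pp D) : ℂ)) / (l : ℂ) ^ (1 - betaJ c' D j) =
        cd ^ (-beta6 D) * (u : ℂ) / (Real.log (Skeleton.P1 D) : ℂ) *
            (χ (l : ZMod D) / (l : ℂ) ^ e) +
          cd ^ (-beta6 D) / (Real.log (Skeleton.P1 D) : ℂ) *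
            (χ (l : ZMod D) * (Real.log l : ℂ) / (l : ℂ) ^ e) := by
    intro l hl
    rw [Finset.mem_Ico] at hl
    have hl1 : 1 ≤ l := hl.1
    have hl0 : (0 : ℝ) < l := by exact_mod_cast hl1
    have hlC : (l : ℂ) ≠ 0 := by exact_mod_cast (Nat.pos_iff_ne_zero.mp hl1)
    have hsplit : (((d * l : ℕ) : ℝ) / P1pp D : ℝ) = (d : ℝ) / P1pp D * l := by
      push_cast; ring
    have hcpow : ((((d * l : ℕ) : ℝ) / P1pp D : ℝ) : ℂ) ^ (-beta6 D) =
        cd ^ (-beta6 D) * (l : ℂ) ^ (-beta6 D) := by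
      rw [hsplit, Complex.ofReal_mul, Complex.mul_cpow_ofReal_nonneg hdP.le hl0.le,
        Complex.ofReal_natCast]
    have hlog : Real.log (((d * l : ℕ) : ℝ) / P1pp D) = u + Real.log l := by
      rw [hsplit, Real.log_mul hdP.ne' hl0.ne']
    rw [hcpow, hlog]
    have hq : (l : ℂ) ^ (-beta6 D) / (l : ℂ) ^ (1 - betaJ c' D j) = 1 / (l : ℂ) ^ e :=
      cpow_neg_div_cpow_one_sub' hlC _ _
    have hinv : (((Real.log (Skeleton.P1 D))⁻¹ : ℝ) : ℂ) = ((Real.log (Skeleton.P1 D) : ℂ))⁻¹ :=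
      Complex.ofReal_inv _
    rw [hinv]
    calc χ (l : ZMod D) * (((Real.log (Skeleton.P1 D) : ℂ))⁻¹ *
            (cd ^ (-beta6 D) * (l : ℂ) ^ (-beta6 D)) * ((u + Real.log l : ℝ) : ℂ)) /
            (l : ℂ) ^ (1 - betaJ c' D j)
        = χ (l : ZMod D) * ((Real.log (Skeleton.P1 D) : ℂ))⁻¹ * cd ^ (-beta6 D) *
            ((u + Real.log l : ℝ) : ℂ) * ((l : ℂ) ^ (-beta6 D) / (l : ℂ) ^ (1 - betaJ c' D j)) := by
          ring
      _ = χ (l : ZMod D) * ((Real.log (Skeleton.P1 D) : ℂ))⁻¹ * cd ^ (-beta6 D) *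
            ((u + Real.log l : ℝ) : ℂ) * (1 / (l : ℂ) ^ e) := by rw [hq]
      _ = _ := by push_cast; ring
  rw [Finset.sum_congr rfl hterm, Finset.sum_add_distrib, ← Finset.mul_sum, ← Finset.mul_sum,
    line020]

/-- For every `1 ≤ d`: the `l`-sum of Lemma 12.1 is the first displayed line MINUS its head
`l ≤ P″₁/d` (where the cut-off `P″₁ < dl` of `ϰ₁₃` bites).
[cite: Zhang2022LandauSiegel, §12 proof of Lemma 12.1, p. 68] -/
private theorem sum121_eq_line020_sub_head (hD : 3 ≤ D) (j : ℕ) {d : ℕ} (hd : 1 ≤ d) :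
    sum121 c' χ j d = line020 c' χ j d -
      ∑ l ∈ (Finset.Ico 1 ⌈P2pp D / d⌉₊).filter (fun l : ℕ => ¬ P1pp D / d < l),
        χ (l : ZMod D) * ((((Real.log (Skeleton.P1 D))⁻¹ : ℝ) : ℂ) *
          ((((d * l : ℕ) : ℝ) / P1pp D : ℝ) : ℂ) ^ (-beta6 D) *
            (Real.log (((d * l : ℕ) : ℝ) / P1pp D) : ℂ)) / (l : ℂ) ^ (1 - betaJ c' D j) := by
  have hP1pp : 0 < P1pp D := P1pp_pos hD
  have hP2pp : 0 < P2pp D := P2pp_pos hD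
  have hd0 : (0 : ℝ) < d := by exact_mod_cast hd
  rw [← sum_full_eq_line020 c' χ hD j hd, eq_sub_iff_add_eq,
    ← Finset.sum_filter_add_sum_filter_not (Finset.Ico 1 ⌈P2pp D / d⌉₊)
      (fun l : ℕ => P1pp D / d < l), add_left_inj]
  -- what remains: `sum121 = Σ_{l < X, P″₁/d < l} Φ(l)`
  have hsub : Finset.Ico 1 ⌈P2pp D / d⌉₊ ⊆ Finset.Ico 1 ⌈P2pp D⌉₊ := by
    apply Finset.Ico_subset_Ico_right
    apply Nat.ceil_mono
    exact div_le_self hP2pp.le (by exact_mod_cast hd)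
  have hzero : ∀ l ∈ Finset.Ico 1 ⌈P2pp D⌉₊, l ∉ Finset.Ico 1 ⌈P2pp D / d⌉₊ →
      χ (l : ZMod D) * vk13 D (d * l) / (l : ℂ) ^ (1 - betaJ c' D j) = 0 := by
    intro l hl hl'
    rw [Finset.mem_Ico] at hl
    rw [Finset.mem_Ico, not_and, not_lt] at hl'
    have hXl : P2pp D / d ≤ l := Nat.ceil_le.mp (hl' hl.1)
    have hcond : ¬ (P1pp D < ((d * l : ℕ) : ℝ) ∧ ((d * l : ℕ) : ℝ) < P2pp D) := by
      rintro ⟨-, h2⟩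
      rw [div_le_iff₀ hd0] at hXl
      push_cast at h2; nlinarith
    rw [vk13, if_neg hcond]; simp
  rw [Finset.sum_filter, sum121, ← Finset.sum_subset hsub hzero]
  refine Finset.sum_congr rfl ?_
  · intro l hl
    rw [Finset.mem_Ico] at hl
    have hlX : (l : ℝ) < P2pp D / d := Nat.lt_ceil.mp hl.2
    by_cases hc : P1pp D / d < l
    · rw [if_pos hc]
      have hcond : P1pp D < ((d * l : ℕ) : ℝ) ∧ ((d * l : ℕ) : ℝ) < P2pp D := by
        push_cast
        constructor
        · rw [div_lt_iff₀ hd0] at hc; linarith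
        · rw [lt_div_iff₀ hd0] at hlX; linarith
      rw [vk13, if_pos hcond]
    · rw [if_neg hc]
      have hcond : ¬ (P1pp D < ((d * l : ℕ) : ℝ) ∧ ((d * l : ℕ) : ℝ) < P2pp D) := by
        rintro ⟨h1, -⟩
        apply hc
        rw [div_lt_iff₀ hd0]
        push_cast at h1; linarith
      rw [vk13, if_neg hcond]; simp

/-- The head is small: `‖Σ_{l ≤ Y} Φ(l)‖ ≤ (log P₁)⁻¹ log Y (1 + log Y)` for `Y = P″₁/d ≥ 1`
(`|Φ(l)| ≤ (log P₁)⁻¹ log(Y/l)/l`, harmonic sum). [cite: Zhang2022LandauSiegel, §12 proof of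
Lemma 12.1, p. 68] -/
private theorem norm_head_le (hD : 3 ≤ D) {j : ℕ} (hj : (betaJ c' D j).re = 0) {d : ℕ}
    (hd : 1 ≤ d) (hdY : (d : ℝ) ≤ P1pp D) (hlogP1 : 0 < Real.log (Skeleton.P1 D)) :
    ‖∑ l ∈ (Finset.Ico 1 ⌈P2pp D / d⌉₊).filter (fun l : ℕ => ¬ P1pp D / d < l),
        χ (l : ZMod D) * ((((Real.log (Skeleton.P1 D))⁻¹ : ℝ) : ℂ) *
          ((((d * l : ℕ) : ℝ) / P1pp D : ℝ) : ℂ) ^ (-beta6 D) *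
            (Real.log (((d * l : ℕ) : ℝ) / P1pp D) : ℂ)) / (l : ℂ) ^ (1 - betaJ c' D j)‖ ≤
      (Real.log (Skeleton.P1 D))⁻¹ * Real.log (P1pp D / d) * (1 + Real.log (P1pp D / d)) := by
  have hP1pp : 0 < P1pp D := P1pp_pos hD
  have hd0 : (0 : ℝ) < d := by exact_mod_cast hd
  set Y : ℝ := P1pp D / d with hY
  have hY1 : 1 ≤ Y := by rw [hY, le_div_iff₀ hd0, one_mul]; exact hdY
  have hY0 : 0 < Y := by linarith
  have hlogY : 0 ≤ Real.log Y := Real.log_nonneg hY1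
  -- the filtered index set sits inside `[1, ⌊Y⌋]`
  have hsub : (Finset.Ico 1 ⌈P2pp D / d⌉₊).filter (fun l : ℕ => ¬ Y < l) ⊆
      Finset.Icc 1 ⌊Y⌋₊ := by
    intro l hl
    rw [Finset.mem_filter, Finset.mem_Ico, not_lt] at hl
    rw [Finset.mem_Icc]
    exact ⟨hl.1.1, Nat.le_floor hl.2⟩
  -- termwise bound
  have hterm : ∀ l ∈ (Finset.Ico 1 ⌈P2pp D / d⌉₊).filter (fun l : ℕ => ¬ Y < l),
      ‖χ (l : ZMod D) * ((((Real.log (Skeleton.P1 D))⁻¹ : ℝ) : ℂ) *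
          ((((d * l : ℕ) : ℝ) / P1pp D : ℝ) : ℂ) ^ (-beta6 D) *
            (Real.log (((d * l : ℕ) : ℝ) / P1pp D) : ℂ)) / (l : ℂ) ^ (1 - betaJ c' D j)‖ ≤
        (Real.log (Skeleton.P1 D))⁻¹ * Real.log Y * (1 / (l : ℝ)) := by
    intro l hl
    rw [Finset.mem_filter, Finset.mem_Ico, not_lt] at hl
    have hl1 : 1 ≤ l := hl.1.1
    have hl0 : (0 : ℝ) < l := by exact_mod_cast hl1
    have hlY : (l : ℝ) ≤ Y := hl.2
    have hdl : 0 < ((d * l : ℕ) : ℝ) / P1pp D := by push_cast; positivity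
    have hdl' : (((d * l : ℕ) : ℝ) / P1pp D : ℝ) = l / Y := by
      rw [hY]; push_cast; field_simp
    have hβ6re : (-beta6 D).re = 0 := by
      rw [Complex.neg_re]; simp [beta6]
    rw [norm_div, norm_mul, norm_mul, norm_mul, Complex.norm_real, Complex.norm_real,
      Complex.norm_cpow_eq_rpow_re_of_pos hdl, hβ6re, Real.rpow_zero, mul_one,
      Complex.norm_natCast_cpow_of_pos (Nat.pos_iff_ne_zero.mp hl1 |> Nat.pos_of_ne_zero),
      Complex.sub_re, Complex.one_re, hj, sub_zero, Real.rpow_one, Real.norm_eq_abs,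
      abs_of_pos (inv_pos.mpr hlogP1), Real.norm_eq_abs, hdl']
    have hχ : ‖χ (l : ZMod D)‖ ≤ 1 := DirichletCharacter.norm_le_one χ _
    have hlogabs : |Real.log (l / Y)| ≤ Real.log Y := by
      rw [Real.log_div hl0.ne' hY0.ne', abs_sub_comm, abs_of_nonneg (by
        have := Real.log_le_log hl0 hlY; linarith)]
      have : 0 ≤ Real.log l := Real.log_nonneg (by exact_mod_cast hl1)
      linarith
    calc ‖χ (l : ZMod D)‖ * ((Real.log (Skeleton.P1 D))⁻¹ * |Real.log (l / Y)|) / (l : ℝ)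
        ≤ 1 * ((Real.log (Skeleton.P1 D))⁻¹ * Real.log Y) / (l : ℝ) := by
          gcongr
      _ = (Real.log (Skeleton.P1 D))⁻¹ * Real.log Y * (1 / (l : ℝ)) := by ring
  -- the harmonic sum
  have hharm : ∑ l ∈ Finset.Icc 1 ⌊Y⌋₊, (1 / (l : ℝ)) ≤ 1 + Real.log Y := by
    have h1 : ∑ l ∈ Finset.Icc 1 ⌊Y⌋₊, (1 / (l : ℝ)) =
        ∑ n ∈ Finset.range ⌊Y⌋₊, 1 / ((n + 1 : ℕ) : ℝ) := by
      have hIcc : Finset.Icc 1 ⌊Y⌋₊ = Finset.Ico 1 (⌊Y⌋₊ + 1) := by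
        ext l; simp only [Finset.mem_Icc, Finset.mem_Ico]; omega
      rw [hIcc, Finset.sum_Ico_eq_sum_range, Nat.add_sub_cancel]
      refine Finset.sum_congr rfl fun n _ => ?_
      rw [add_comm]
    rw [h1]
    refine (Lemma82.sum_inv_le_one_add_log ⌊Y⌋₊).trans ?_
    have hfl : (1 : ℝ) ≤ ⌊Y⌋₊ := by exact_mod_cast Nat.floor_pos.mpr hY1
    have : Real.log (⌊Y⌋₊ : ℝ) ≤ Real.log Y := Real.log_le_log (by linarith) (Nat.floor_le hY0.le)
    linarith
  calc ‖∑ l ∈ (Finset.Ico 1 ⌈P2pp D / d⌉₊).filter (fun l : ℕ => ¬ Y < l), _‖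
      ≤ ∑ l ∈ (Finset.Ico 1 ⌈P2pp D / d⌉₊).filter (fun l : ℕ => ¬ Y < l), ‖_‖ := norm_sum_le _ _
    _ ≤ ∑ l ∈ (Finset.Ico 1 ⌈P2pp D / d⌉₊).filter (fun l : ℕ => ¬ Y < l),
          (Real.log (Skeleton.P1 D))⁻¹ * Real.log Y * (1 / (l : ℝ)) := Finset.sum_le_sum hterm
    _ ≤ ∑ l ∈ Finset.Icc 1 ⌊Y⌋₊, (Real.log (Skeleton.P1 D))⁻¹ * Real.log Y * (1 / (l : ℝ)) :=
        Finset.sum_le_sum_of_subset_of_nonneg hsub fun l _ _ => by positivity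
    _ = (Real.log (Skeleton.P1 D))⁻¹ * Real.log Y * ∑ l ∈ Finset.Icc 1 ⌊Y⌋₊, (1 / (l : ℝ)) := by
        rw [Finset.mul_sum]
    _ ≤ (Real.log (Skeleton.P1 D))⁻¹ * Real.log Y * (1 + Real.log Y) :=
        mul_le_mul_of_nonneg_left hharm (by positivity)

end RangeTwo

/-! ### Clause (ii)′: the surviving weak form on `P″₁/T < d ≤ P″₁` -/

section RangeTwoMain

variable (c' : ℝ)

set_option maxHeartbeats 800000 in
-- one long assembly: above the default budget
/-- The weak form of clause (ii), from the closed form of the first line (hypothesis `h20`, the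
theorem `line020_closed_form` of `Section12Lemma121`). [cite: Zhang2022LandauSiegel, §12 Lemma 12.1,
p. 68] -/
private theorem range_two_weak_of
    (h20 : ∃ C : ℝ, ForAllLarge fun D _ χ => AssumptionA D χ →
      ∀ j ∈ ({1, 2, 3} : Finset ℕ), ∀ d : ℕ, 1 ≤ d → (d : ℝ) < Skeleton.P2 D →
        ‖line020 c' χ j d -
            deriv χ.LFunction 1 * ((d / P1pp D : ℝ) : ℂ) ^ (-beta6 D) /
                (Real.log (Skeleton.P1 D) : ℂ) *
              (-1 + (beta6 D - betaJ c' D j) * (Real.log (d / P1pp D) : ℂ))‖ ≤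
          C * (ell D ^ 15)⁻¹) :
    ∃ C : ℝ, ForAllLarge fun D _ χ => AssumptionA D χ →
      ∀ j ∈ ({1, 2, 3} : Finset ℕ), ∀ d : ℕ, 1 ≤ d → P1pp D / bigT D < d → (d : ℝ) ≤ P1pp D →
        ‖sum121 c' χ j d‖ ≤
          C * (‖deriv χ.LFunction 1‖ + Real.log D ^ (2.2 : ℝ)) / Real.log D ^ 9 := by
  obtain ⟨C₀, D₀, h⟩ := h20
  refine ⟨(4 + |C₀|) / 0.504, max D₀ ⌈Real.exp (20 + 32 * |c'|)⌉₊,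
    fun D _ χ hD hq hp hA j hj d hd hdlow hdup => ?_⟩
  have hπ := Real.pi_pos
  have hc0 : 0 ≤ |c'| := abs_nonneg _
  have hC0 : 0 ≤ |C₀| := abs_nonneg _
  have hD₀ : D₀ ≤ D := le_trans (le_max_left _ _) hD
  have hDexp : Real.exp (20 + 32 * |c'|) ≤ D :=
    le_trans (Nat.le_ceil _) (by exact_mod_cast le_trans (le_max_right _ _) hD)
  have hD0 : (0 : ℝ) < D := lt_of_lt_of_le (Real.exp_pos _) hDexp
  obtain ⟨L, hLdef⟩ : ∃ L : ℝ, L = Real.log D := ⟨_, rfl⟩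
  have hL : 20 + 32 * |c'| ≤ L := by rw [hLdef]; exact (Real.le_log_iff_exp_le hD0).mpr hDexp
  have hL20 : 20 ≤ L := by linarith
  have hL1 : 1 ≤ L := by linarith
  have hL0 : 0 < L := by linarith
  have hell : ell D = L := hLdef.symm
  have hDr : (21 : ℝ) ≤ D := by
    have := Real.log_le_sub_one_of_pos hD0; rw [← hLdef] at this; linarith
  have hD3 : 3 ≤ D := by exact_mod_cast (show (3 : ℝ) ≤ D by linarith)
  have hP : 0 < bigP D := Real.exp_pos _
  have hT : 0 < bigT D := Real.exp_pos _
  have hP1pp : 0 < P1pp D := P1pp_pos hD3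
  have hd0 : (0 : ℝ) < d := by exact_mod_cast hd
  have hlogP1 : Real.log (Skeleton.P1 D) = 0.504 * L ^ 9 := by
    rw [Skeleton.P1, Real.log_rpow hP, bigP, Real.log_exp, hell]
  have hlogP1pos : 0 < Real.log (Skeleton.P1 D) := by rw [hlogP1]; positivity
  -- powers of `L`
  have hL7 : (1.28e9 : ℝ) ≤ L ^ 7 := by
    have := pow_le_pow_left₀ (by norm_num) hL20 7; norm_num at this; linarith
  have hL2 : (400 : ℝ) ≤ L ^ 2 := by nlinarith
  have hLL2 : L ≤ L ^ 2 := by nlinarith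
  have hL9low : 1.28e9 * L ^ 2 ≤ L ^ 9 := by
    rw [show L ^ 9 = L ^ 7 * L ^ 2 by ring]; exact mul_le_mul_of_nonneg_right hL7 (by positivity)
  have h11 : L ^ (1.1 : ℝ) ≤ L ^ 2 := by
    calc L ^ (1.1 : ℝ) ≤ L ^ ((2 : ℕ) : ℝ) := Real.rpow_le_rpow_of_exponent_le hL1 (by norm_num)
      _ = L ^ 2 := Real.rpow_natCast L 2
  have h11nn : 0 ≤ L ^ (1.1 : ℝ) := Real.rpow_nonneg hL0.le _
  have h22 : L ^ (2.2 : ℝ) = L ^ (1.1 : ℝ) * L ^ (1.1 : ℝ) := by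
    rw [← Real.rpow_add hL0]; norm_num
  have h1122 : L ^ (1.1 : ℝ) ≤ L ^ (2.2 : ℝ) := Real.rpow_le_rpow_of_exponent_le hL1 (by norm_num)
  have h22one : 1 ≤ L ^ (2.2 : ℝ) := Real.one_le_rpow hL1 (by norm_num)
  have hlogL : Real.log L ≤ L := by have := Real.log_le_sub_one_of_pos hL0; linarith
  -- `d < P₂` (indeed `P″₁ < P₂`)
  have hdP2 : (d : ℝ) < Skeleton.P2 D := by
    have hlogP2 : Real.log (Skeleton.P2 D) = 0.5 * L ^ 9 - 10 * L ^ (1.1 : ℝ) := by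
      rw [Skeleton.P2, Real.log_div (Real.rpow_pos_of_pos hP _).ne' (pow_pos hT 10).ne',
        Real.log_rpow hP, Real.log_pow, bigT, Real.log_exp, bigP, Real.log_exp, hell]
      push_cast; ring
    have hlogP1pp : Real.log (P1pp D) = 0.496 * L ^ 9 + L + 519 * Real.log L := by
      have ht0 : 0 < t0 D := by rw [t0, hell]; positivity
      rw [P1pp, Real.log_mul (by positivity) ht0.ne', Real.log_mul (Real.rpow_pos_of_pos hP _).ne'
        hD0.ne', Real.log_rpow hP, bigP, Real.log_exp, t0, Real.log_pow, hell, ← hLdef]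
      push_cast; ring
    have hP2pos : 0 < Skeleton.P2 D := by rw [Skeleton.P2]; positivity
    have hlt : Real.log (P1pp D) < Real.log (Skeleton.P2 D) := by
      rw [hlogP2, hlogP1pp]; linarith
    exact lt_of_le_of_lt hdup ((Real.log_lt_log_iff hP1pp hP2pos).mp hlt)
  -- the inputs
  have hclosed := h D χ hD₀ hq hp hA j hj d hd hdP2
  rw [hell] at hclosed
  obtain ⟨hβjre, hβjn⟩ := betaJ_re_and_norm' c' (by linarith) hj
  rw [← hLdef] at hβjn
  have hdecomp := sum121_eq_line020_sub_head c' χ hD3 j hd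
  have hhead := norm_head_le c' χ hD3 hβjre hd hdup hlogP1pos
  -- `Y = P″₁/d ∈ [1, T)`: `log Y < 𝓛^{1.1}`
  have hY1 : 1 ≤ P1pp D / d := by rw [le_div_iff₀ hd0, one_mul]; exact hdup
  have hYT : P1pp D / d < bigT D := by rw [div_lt_iff₀ hd0]; rw [div_lt_iff₀ hT] at hdlow; linarith
  have hlogY0 : 0 ≤ Real.log (P1pp D / d) := Real.log_nonneg hY1
  have hlogY : Real.log (P1pp D / d) ≤ L ^ (1.1 : ℝ) := by
    have h1 : Real.log (P1pp D / d) < Real.log (bigT D) := Real.log_lt_log (by linarith) hYT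
    rw [bigT, Real.log_exp, hell] at h1; exact h1.le
  -- the head: `≤ 2𝓛^{2.2}/(0.504𝓛⁹)`
  have hhead' : ‖∑ l ∈ (Finset.Ico 1 ⌈P2pp D / d⌉₊).filter (fun l : ℕ => ¬ P1pp D / d < l),
      χ (l : ZMod D) * ((((Real.log (Skeleton.P1 D))⁻¹ : ℝ) : ℂ) *
        ((((d * l : ℕ) : ℝ) / P1pp D : ℝ) : ℂ) ^ (-beta6 D) *
          (Real.log (((d * l : ℕ) : ℝ) / P1pp D) : ℂ)) / (l : ℂ) ^ (1 - betaJ c' D j)‖ ≤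
      2 * L ^ (2.2 : ℝ) / (0.504 * L ^ 9) := by
    refine hhead.trans ?_
    rw [hlogP1]
    have h1 : Real.log (P1pp D / d) * (1 + Real.log (P1pp D / d)) ≤ 2 * L ^ (2.2 : ℝ) := by
      calc Real.log (P1pp D / d) * (1 + Real.log (P1pp D / d))
          ≤ L ^ (1.1 : ℝ) * (1 + L ^ (1.1 : ℝ)) := by
            exact mul_le_mul hlogY (by linarith) (by linarith) h11nn
        _ = L ^ (1.1 : ℝ) + L ^ (2.2 : ℝ) := by rw [h22]; ring
        _ ≤ 2 * L ^ (2.2 : ℝ) := by linarith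
    rw [mul_assoc, show 2 * L ^ (2.2 : ℝ) / (0.504 * L ^ 9) = (0.504 * L ^ 9)⁻¹ * (2 * L ^ (2.2 : ℝ))
      by rw [div_eq_inv_mul]]
    exact mul_le_mul_of_nonneg_left h1 (by positivity)
  -- the main term: `≤ 2‖L′‖/(0.504𝓛⁹)`
  have hα : alpha D = π / L ^ 9 := by rw [alpha, bigP, Real.log_exp, hell]
  have hβ6eq : beta6 D = ((3 / 2 * (π / L ^ 9) : ℝ) : ℂ) * I := by rw [beta6, hα]; push_cast; ring
  have hβ6re : (beta6 D).re = 0 := by rw [hβ6eq]; exact Lemma82.re_ofReal_mul_I _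
  have hβ6n : ‖beta6 D‖ ≤ (3 + 5 * |c'|) * (π / L ^ 9) := by
    rw [hβ6eq, Lemma82.norm_ofReal_mul_I, abs_of_pos (by positivity)]
    have h0 : 0 ≤ π / L ^ 9 := by positivity
    nlinarith only [h0, hc0]
  have hδ : ‖beta6 D - betaJ c' D j‖ ≤ (6 + 10 * |c'|) * π / L ^ 9 := by
    calc ‖beta6 D - betaJ c' D j‖ ≤ ‖beta6 D‖ + ‖betaJ c' D j‖ := norm_sub_le _ _
      _ ≤ (3 + 5 * |c'|) * (π / L ^ 9) + (3 + 5 * |c'|) * (π / L ^ 9) := add_le_add hβ6n hβjn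
      _ = (6 + 10 * |c'|) * π / L ^ 9 := by ring
  have hδu : ‖beta6 D - betaJ c' D j‖ * |Real.log ((d : ℝ) / P1pp D)| ≤ 1 := by
    have hu : |Real.log ((d : ℝ) / P1pp D)| = Real.log (P1pp D / d) := by
      rw [show (d : ℝ) / P1pp D = (P1pp D / d)⁻¹ by rw [inv_div], Real.log_inv, abs_neg,
        abs_of_nonneg hlogY0]
    rw [hu]
    have h1 : ‖beta6 D - betaJ c' D j‖ * Real.log (P1pp D / d) ≤
        (6 + 10 * |c'|) * π / L ^ 9 * L ^ 2 :=
      mul_le_mul hδ (hlogY.trans h11) hlogY0 (by positivity)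
    have h2 : (6 + 10 * |c'|) * π / L ^ 9 * L ^ 2 ≤ 1 := by
      rw [div_mul_eq_mul_div, div_le_one (by positivity)]
      have hπ4 : π < 3.15 := Real.pi_lt_d2
      have hL7' : L ≤ L ^ 7 := by
        calc L = L ^ 1 := (pow_one _).symm
          _ ≤ L ^ 7 := pow_le_pow_right₀ hL1 (by norm_num)
      have : (6 + 10 * |c'|) * π ≤ L := by nlinarith
      calc (6 + 10 * |c'|) * π * L ^ 2 ≤ L * L ^ 2 := by
            exact mul_le_mul_of_nonneg_right this (by positivity)
        _ ≤ L ^ 7 * L ^ 2 := mul_le_mul_of_nonneg_right hL7' (by positivity)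
        _ = L ^ 9 := by ring
    linarith
  have hdP : 0 < (d : ℝ) / P1pp D := div_pos hd0 hP1pp
  have hmain : ‖deriv χ.LFunction 1 * (((d : ℝ) / P1pp D : ℝ) : ℂ) ^ (-beta6 D) /
      (Real.log (Skeleton.P1 D) : ℂ) *
        (-1 + (beta6 D - betaJ c' D j) * (Real.log ((d : ℝ) / P1pp D) : ℂ))‖ ≤
      2 * ‖deriv χ.LFunction 1‖ / (0.504 * L ^ 9) := by
    have hcd : ‖(((d : ℝ) / P1pp D : ℝ) : ℂ) ^ (-beta6 D)‖ = 1 := by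
      rw [Complex.norm_cpow_eq_rpow_re_of_pos hdP, Complex.neg_re, hβ6re, neg_zero, Real.rpow_zero]
    have hlP : ‖(Real.log (Skeleton.P1 D) : ℂ)‖ = 0.504 * L ^ 9 := by
      rw [Complex.norm_real, Real.norm_eq_abs, hlogP1, abs_of_pos (by positivity)]
    have hbr : ‖(-1 : ℂ) + (beta6 D - betaJ c' D j) * (Real.log ((d : ℝ) / P1pp D) : ℂ)‖ ≤ 2 := by
      calc ‖(-1 : ℂ) + (beta6 D - betaJ c' D j) * (Real.log ((d : ℝ) / P1pp D) : ℂ)‖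
          ≤ ‖(-1 : ℂ)‖ + ‖(beta6 D - betaJ c' D j) * (Real.log ((d : ℝ) / P1pp D) : ℂ)‖ :=
            norm_add_le _ _
        _ = 1 + ‖beta6 D - betaJ c' D j‖ * |Real.log ((d : ℝ) / P1pp D)| := by
            rw [norm_neg, norm_one, norm_mul, Complex.norm_real, Real.norm_eq_abs]
        _ ≤ 2 := by linarith
    rw [norm_mul, norm_div, norm_mul, hcd, hlP, mul_one]
    rw [show 2 * ‖deriv χ.LFunction 1‖ / (0.504 * L ^ 9) =
      ‖deriv χ.LFunction 1‖ / (0.504 * L ^ 9) * 2 by ring]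
    exact mul_le_mul_of_nonneg_left hbr (by positivity)
  -- assemble
  have hline : ‖line020 c' χ j d‖ ≤ 2 * ‖deriv χ.LFunction 1‖ / (0.504 * L ^ 9) + |C₀| * (L ^ 15)⁻¹ := by
    have htri := norm_le_norm_add_norm_sub' (line020 c' χ j d)
      (deriv χ.LFunction 1 * (((d : ℝ) / P1pp D : ℝ) : ℂ) ^ (-beta6 D) /
        (Real.log (Skeleton.P1 D) : ℂ) *
          (-1 + (beta6 D - betaJ c' D j) * (Real.log ((d : ℝ) / P1pp D) : ℂ)))
    have hC : C₀ * (L ^ 15)⁻¹ ≤ |C₀| * (L ^ 15)⁻¹ :=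
      mul_le_mul_of_nonneg_right (le_abs_self _) (by positivity)
    linarith
  have hgoal : ‖sum121 c' χ j d‖ ≤ 2 * ‖deriv χ.LFunction 1‖ / (0.504 * L ^ 9) +
      |C₀| * (L ^ 15)⁻¹ + 2 * L ^ (2.2 : ℝ) / (0.504 * L ^ 9) := by
    rw [hdecomp]
    exact (norm_sub_le _ _).trans (add_le_add hline hhead')
  refine hgoal.trans ?_
  rw [← hLdef]
  -- `|C₀|/𝓛¹⁵ ≤ |C₀|𝓛^{2.2}/(0.504𝓛⁹)`
  have hL6 : (1 : ℝ) ≤ 0.504 * L ^ 6 := by nlinarith [pow_le_pow_left₀ (by norm_num : (0:ℝ) ≤ 20) hL20 6]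
  have hmid : |C₀| * (L ^ 15)⁻¹ ≤ |C₀| * L ^ (2.2 : ℝ) / (0.504 * L ^ 9) := by
    rw [div_eq_mul_inv, mul_assoc]
    refine mul_le_mul_of_nonneg_left ?_ hC0
    rw [← div_eq_mul_inv, le_div_iff₀ (by positivity)]
    calc (L ^ 15)⁻¹ * (0.504 * L ^ 9) = 0.504 / L ^ 6 := by field_simp
      _ ≤ 1 := by
          rw [div_le_one (by positivity)]
          nlinarith [pow_le_pow_left₀ (by norm_num : (0:ℝ) ≤ 20) hL20 6]
      _ ≤ L ^ (2.2 : ℝ) := h22one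
  have hnn : 0 ≤ ‖deriv χ.LFunction 1‖ := norm_nonneg _
  calc 2 * ‖deriv χ.LFunction 1‖ / (0.504 * L ^ 9) + |C₀| * (L ^ 15)⁻¹ +
        2 * L ^ (2.2 : ℝ) / (0.504 * L ^ 9)
      ≤ 2 * ‖deriv χ.LFunction 1‖ / (0.504 * L ^ 9) + |C₀| * L ^ (2.2 : ℝ) / (0.504 * L ^ 9) +
          2 * L ^ (2.2 : ℝ) / (0.504 * L ^ 9) := by linarith
    _ = (2 * ‖deriv χ.LFunction 1‖ + (|C₀| + 2) * L ^ (2.2 : ℝ)) / 0.504 / L ^ 9 := by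
        field_simp; ring
    _ ≤ ((4 + |C₀|) * (‖deriv χ.LFunction 1‖ + L ^ (2.2 : ℝ))) / 0.504 / L ^ 9 := by
        gcongr
        nlinarith
    _ = (4 + |C₀|) / 0.504 * (‖deriv χ.LFunction 1‖ + L ^ (2.2 : ℝ)) / L ^ 9 := by ring

/-- **Lemma 12.1 clause (ii), SURVIVING WEAK FORM (ledger `G-d35-1`)**: for every real `c′`, under
(A), for all large `D`, `j ∈ {1,2,3}` and `P″₁/T < d ≤ P″₁`:
`‖Σ_l χ(l)ϰ₁₃(dl)l^{β_j−1}‖ ≤ C·(|L′(1,χ)| + 𝓛^{2.2})/𝓛⁹`.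
The printed claim is `≪ α₁` (`= α𝓛 = π𝓛⁻⁸` in the banked reading, `α log T = π𝓛^{−7.9}` in the
reading of record); at `d = ⌊P″₁⌋` the sum equals `−L′(1,χ)(d/P″₁)^{−β₆}/log P₁ + O(𝓛⁻¹⁵)`
(`line020_closed_form` minus an empty head), so the printed strength needs `L′(1,χ) ≪ 𝓛` (resp.
`𝓛^{1.1}`) UNDER (A) — not in print, FACT-LIST or tree; what IS derivable is this bound (closed form
of the first line for all `d < P₂`, `Typed.Sec12B.line020_closed_form`, minus the head `l ≤ P″₁/d`,
bounded by `(log P₁)⁻¹log Y(1 + log Y)`, `Y = P″₁/d < T`). With the tree's trivial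
`|L′(1,χ)| ≤ 4e^{9/2}𝓛²` this is `O(𝓛^{−6.8}) = O(α𝓛^{2.2})`, which keeps the range's contribution to
`S_j(𝐚₁₅,𝐚₂₂)` (§12 p. 73) at `o(α)` with room. [cite: Zhang2022LandauSiegel, §12 Lemma 12.1, p. 68] -/
theorem sum121_range_two_weak : ∃ C : ℝ, ForAllLarge fun D _ χ => AssumptionA D χ →
    ∀ j ∈ ({1, 2, 3} : Finset ℕ), ∀ d : ℕ, 1 ≤ d → P1pp D / bigT D < d → (d : ℝ) ≤ P1pp D →
      ‖sum121 c' χ j d‖ ≤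
        C * (‖deriv χ.LFunction 1‖ + Real.log D ^ (2.2 : ℝ)) / Real.log D ^ 9 :=
  range_two_weak_of c' (line020_closed_form c')

/-- The same with the tree's unconditional bound `|L′(1,χ)| ≤ 2e^{9/2}(1+𝓛)𝓛 ≤ 4e^{9/2}𝓛²`
(`Lemma31.norm_deriv_LFunction_le_near_one`): on `P″₁/T < d ≤ P″₁`,
`‖Σ_l χ(l)ϰ₁₃(dl)l^{β_j−1}‖ ≤ C·𝓛^{2.2}/𝓛⁹` (vs. the printed `≪ α₁`). [cite: Zhang2022LandauSiegel,
§12 Lemma 12.1, p. 68] -/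
theorem sum121_range_two_weak' : ∃ C : ℝ, ForAllLarge fun D _ χ => AssumptionA D χ →
    ∀ j ∈ ({1, 2, 3} : Finset ℕ), ∀ d : ℕ, 1 ≤ d → P1pp D / bigT D < d → (d : ℝ) ≤ P1pp D →
      ‖sum121 c' χ j d‖ ≤ C * Real.log D ^ (2.2 : ℝ) / Real.log D ^ 9 := by
  obtain ⟨C, D₀, h⟩ := sum121_range_two_weak c'
  refine ⟨|C| * (4 * Real.exp (9 / 2) + 1), max D₀ ⌈Real.exp 3⌉₊,
    fun D _ χ hD hq hp hA j hj d hd hdlow hdup => ?_⟩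
  have hD₀ : D₀ ≤ D := le_trans (le_max_left _ _) hD
  have hDexp : Real.exp 3 ≤ D :=
    le_trans (Nat.le_ceil _) (by exact_mod_cast le_trans (le_max_right _ _) hD)
  have hD0 : (0 : ℝ) < D := lt_of_lt_of_le (Real.exp_pos _) hDexp
  have hL3 : 3 ≤ Real.log D := (Real.le_log_iff_exp_le hD0).mpr hDexp
  have hL1 : 1 ≤ Real.log D := by linarith
  have hL0 : 0 < Real.log D := by linarith
  have key := h D χ hD₀ hq hp hA j hj d hd hdlow hdup
  have hderiv : ‖deriv χ.LFunction 1‖ ≤ 4 * Real.exp (9 / 2) * Real.log D ^ (2.2 : ℝ) := by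
    have hw : ‖(1 : ℂ) - 1‖ ≤ 1 / Real.log D := by
      rw [sub_self, norm_zero]; positivity
    refine (Lemma31.norm_deriv_LFunction_le_near_one χ hL3 hp hw).trans ?_
    have h2 : Real.log D ^ 2 ≤ Real.log D ^ (2.2 : ℝ) := by
      calc Real.log D ^ 2 = Real.log D ^ ((2 : ℕ) : ℝ) := (Real.rpow_natCast _ 2).symm
        _ ≤ Real.log D ^ (2.2 : ℝ) := Real.rpow_le_rpow_of_exponent_le hL1 (by norm_num)
    have h1 : (1 + Real.log D) * Real.log D ≤ 2 * Real.log D ^ 2 := by nlinarith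
    have h0 : 0 ≤ 2 * Real.exp (9 / 2) := by positivity
    nlinarith
  have hC : C ≤ |C| := le_abs_self C
  have h22 : 0 ≤ Real.log D ^ (2.2 : ℝ) := Real.rpow_nonneg hL0.le _
  calc ‖sum121 c' χ j d‖ ≤ C * (‖deriv χ.LFunction 1‖ + Real.log D ^ (2.2 : ℝ)) / Real.log D ^ 9 :=
        key
    _ ≤ |C| * (‖deriv χ.LFunction 1‖ + Real.log D ^ (2.2 : ℝ)) / Real.log D ^ 9 := by
        gcongr
    _ ≤ |C| * ((4 * Real.exp (9 / 2) + 1) * Real.log D ^ (2.2 : ℝ)) / Real.log D ^ 9 := by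
        gcongr; linarith
    _ = |C| * (4 * Real.exp (9 / 2) + 1) * Real.log D ^ (2.2 : ℝ) / Real.log D ^ 9 := by ring

end RangeTwoMain

end Literature.NumberTheory.LFunctions.Zhang2022.Typed.Sec12B
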